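import Mathlib
import HarnessLib
import Summits.RiemannHypothesis.RiemannHypothesis.Theorems.DbrWallLogTableB

/-!
# DBR column, rung B-P(P1): two-sided rational enclosures of `log p`, primes `p ≤ 233` (part C: 137 ≤ p ≤ 233)

RH-FREE elementary inequalities (LINE 1 of the label discipline): for each prime `p` in range a lemma
`log_<p>_bounds : lo < Real.log p ∧ Real.log p < hi` with 13-decimal rational `lo, hi` (widths `≤ 1e-12`),
each obtained from Mathlib's `Real.abs_log_sub_add_sum_range_le` (the logarithmic series with remainder)
applied to `log(p/N)` for a smooth neighbour `N` of `p`, plus the bounds already proved for the primes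
dividing `N`. They feed the generic anti-persistence rung certificate (`DbrWallRungKit`): the prime terms
`Λ(n)n^{-1/2}(log q' − log n)` of the two-point gap `2Ψ(s) − Ψ(2s)` at `s = (log q')/2` are bounded below
from these enclosures. Nothing here bears on the truth of RH. [folklore]
-/

set_option linter.dupNamespace false

noncomputable section

namespace Summit.RiemannHypothesis.RiemannHypothesis.Theorems.DbrWall.LogTable

/-- `4.9199809258277 < log 137 < 4.9199809258286` (from `log(136 / 137)` by 6 terms of the logarithmic series; width 9.0e-13). [folklore] -/
theorem log_137_bounds : (4.9199809258277 : ℝ) < Real.log 137 ∧ Real.log 137 < 4.9199809258286 := by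
  have hx : |(1 / 137 : ℝ)| < 1 := by rw [abs_of_pos (by norm_num)]; norm_num
  have h := Real.abs_log_sub_add_sum_range_le hx 6
  have hN : Real.log (136 : ℝ) = 3 * Real.log 2 + Real.log 17 := by
    rw [show (136 : ℝ) = 2 ^ 3 * 17 by norm_num]
    rw [Real.log_mul (by positivity) (by positivity)]
    simp only [Real.log_pow]; push_cast; ring
  have e : Real.log (1 - 1 / 137 : ℝ) = (3 * Real.log 2 + Real.log 17) - Real.log 137 := by
    rw [show (1 - 1 / 137 : ℝ) = (136 : ℝ) / 137 by norm_num, Real.log_div (by norm_num) (by norm_num), hN]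
  rw [e, abs_of_pos (by norm_num : (0:ℝ) < 1 / 137)] at h
  obtain ⟨hl, hu⟩ := abs_le.1 h
  simp only [Finset.sum_range_succ, Finset.sum_range_zero] at hl hu
  norm_num at hl hu
  have hb2 := log_two_bounds
  have hb17 := log_seventeen_bounds
  constructor <;> linarith

/-- `4.9344739331302 < log 139 < 4.9344739331312` (from `log(137 / 139)` by 7 terms of the logarithmic series; width 1.0e-12). [folklore] -/
theorem log_139_bounds : (4.9344739331302 : ℝ) < Real.log 139 ∧ Real.log 139 < 4.9344739331312 := by
  have hx : |(2 / 139 : ℝ)| < 1 := by rw [abs_of_pos (by norm_num)]; norm_num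
  have h := Real.abs_log_sub_add_sum_range_le hx 7
  have e : Real.log (1 - 2 / 139 : ℝ) = (Real.log 137) - Real.log 139 := by
    rw [show (1 - 2 / 139 : ℝ) = (137 : ℝ) / 139 by norm_num, Real.log_div (by norm_num) (by norm_num)]
  rw [e, abs_of_pos (by norm_num : (0:ℝ) < 2 / 139)] at h
  obtain ⟨hl, hu⟩ := abs_le.1 h
  simp only [Finset.sum_range_succ, Finset.sum_range_zero] at hl hu
  norm_num at hl hu
  have hb137 := log_137_bounds
  constructor <;> linarith

/-- `5.0039463059450 < log 149 < 5.0039463059462` (from `log(148 / 149)` by 6 terms of the logarithmic series; width 1.2e-12). [folklore] -/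
theorem log_149_bounds : (5.0039463059450 : ℝ) < Real.log 149 ∧ Real.log 149 < 5.0039463059462 := by
  have hx : |(1 / 149 : ℝ)| < 1 := by rw [abs_of_pos (by norm_num)]; norm_num
  have h := Real.abs_log_sub_add_sum_range_le hx 6
  have hN : Real.log (148 : ℝ) = 2 * Real.log 2 + Real.log 37 := by
    rw [show (148 : ℝ) = 2 ^ 2 * 37 by norm_num]
    rw [Real.log_mul (by positivity) (by positivity)]
    simp only [Real.log_pow]; push_cast; ring
  have e : Real.log (1 - 1 / 149 : ℝ) = (2 * Real.log 2 + Real.log 37) - Real.log 149 := by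
    rw [show (1 - 1 / 149 : ℝ) = (148 : ℝ) / 149 by norm_num, Real.log_div (by norm_num) (by norm_num), hN]
  rw [e, abs_of_pos (by norm_num : (0:ℝ) < 1 / 149)] at h
  obtain ⟨hl, hu⟩ := abs_le.1 h
  simp only [Finset.sum_range_succ, Finset.sum_range_zero] at hl hu
  norm_num at hl hu
  have hb2 := log_two_bounds
  have hb37 := log_thirtyseven_bounds
  constructor <;> linarith

/-- `5.0172798368144 < log 151 < 5.0172798368156` (from `log(151 / 152)` by 6 terms of the logarithmic series; width 1.2e-12). [folklore] -/
theorem log_151_bounds : (5.0172798368144 : ℝ) < Real.log 151 ∧ Real.log 151 < 5.0172798368156 := by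
  have hx : |(1 / 152 : ℝ)| < 1 := by rw [abs_of_pos (by norm_num)]; norm_num
  have h := Real.abs_log_sub_add_sum_range_le hx 6
  have hN : Real.log (152 : ℝ) = 3 * Real.log 2 + Real.log 19 := by
    rw [show (152 : ℝ) = 2 ^ 3 * 19 by norm_num]
    rw [Real.log_mul (by positivity) (by positivity)]
    simp only [Real.log_pow]; push_cast; ring
  have e : Real.log (1 - 1 / 152 : ℝ) = Real.log 151 - (3 * Real.log 2 + Real.log 19) := by
    rw [show (1 - 1 / 152 : ℝ) = (151 : ℝ) / 152 by norm_num, Real.log_div (by norm_num) (by norm_num), hN]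
  rw [e, abs_of_pos (by norm_num : (0:ℝ) < 1 / 152)] at h
  obtain ⟨hl, hu⟩ := abs_le.1 h
  simp only [Finset.sum_range_succ, Finset.sum_range_zero] at hl hu
  norm_num at hl hu
  have hb2 := log_two_bounds
  have hb19 := log_nineteen_bounds
  constructor <;> linarith

/-- `5.0562458053477 < log 157 < 5.0562458053492` (from `log(157 / 158)` by 6 terms of the logarithmic series; width 1.5e-12). [folklore] -/
theorem log_157_bounds : (5.0562458053477 : ℝ) < Real.log 157 ∧ Real.log 157 < 5.0562458053492 := by
  have hx : |(1 / 158 : ℝ)| < 1 := by rw [abs_of_pos (by norm_num)]; norm_num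
  have h := Real.abs_log_sub_add_sum_range_le hx 6
  have hN : Real.log (158 : ℝ) = Real.log 2 + Real.log 79 := by
    rw [show (158 : ℝ) = 2 * 79 by norm_num]
    rw [Real.log_mul (by positivity) (by positivity)]
  have e : Real.log (1 - 1 / 158 : ℝ) = Real.log 157 - (Real.log 2 + Real.log 79) := by
    rw [show (1 - 1 / 158 : ℝ) = (157 : ℝ) / 158 by norm_num, Real.log_div (by norm_num) (by norm_num), hN]
  rw [e, abs_of_pos (by norm_num : (0:ℝ) < 1 / 158)] at h
  obtain ⟨hl, hu⟩ := abs_le.1 h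
  simp only [Finset.sum_range_succ, Finset.sum_range_zero] at hl hu
  norm_num at hl hu
  have hb2 := log_two_bounds
  have hb79 := log_seventynine_bounds
  constructor <;> linarith

/-- `5.0937502008062 < log 163 < 5.0937502008076` (from `log(162 / 163)` by 6 terms of the logarithmic series; width 1.4e-12). [folklore] -/
theorem log_163_bounds : (5.0937502008062 : ℝ) < Real.log 163 ∧ Real.log 163 < 5.0937502008076 := by
  have hx : |(1 / 163 : ℝ)| < 1 := by rw [abs_of_pos (by norm_num)]; norm_num
  have h := Real.abs_log_sub_add_sum_range_le hx 6
  have hN : Real.log (162 : ℝ) = Real.log 2 + 4 * Real.log 3 := by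
    rw [show (162 : ℝ) = 2 * 3 ^ 4 by norm_num]
    rw [Real.log_mul (by positivity) (by positivity)]
    simp only [Real.log_pow]; push_cast; ring
  have e : Real.log (1 - 1 / 163 : ℝ) = (Real.log 2 + 4 * Real.log 3) - Real.log 163 := by
    rw [show (1 - 1 / 163 : ℝ) = (162 : ℝ) / 163 by norm_num, Real.log_div (by norm_num) (by norm_num), hN]
  rw [e, abs_of_pos (by norm_num : (0:ℝ) < 1 / 163)] at h
  obtain ⟨hl, hu⟩ := abs_le.1 h
  simp only [Finset.sum_range_succ, Finset.sum_range_zero] at hl hu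
  norm_num at hl hu
  have hb2 := log_two_bounds
  have hb3 := log_three_bounds
  constructor <;> linarith

/-- `5.1179938124162 < log 167 < 5.1179938124177` (from `log(166 / 167)` by 6 terms of the logarithmic series; width 1.5e-12). [folklore] -/
theorem log_167_bounds : (5.1179938124162 : ℝ) < Real.log 167 ∧ Real.log 167 < 5.1179938124177 := by
  have hx : |(1 / 167 : ℝ)| < 1 := by rw [abs_of_pos (by norm_num)]; norm_num
  have h := Real.abs_log_sub_add_sum_range_le hx 6
  have hN : Real.log (166 : ℝ) = Real.log 2 + Real.log 83 := by
    rw [show (166 : ℝ) = 2 * 83 by norm_num]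
    rw [Real.log_mul (by positivity) (by positivity)]
  have e : Real.log (1 - 1 / 167 : ℝ) = (Real.log 2 + Real.log 83) - Real.log 167 := by
    rw [show (1 - 1 / 167 : ℝ) = (166 : ℝ) / 167 by norm_num, Real.log_div (by norm_num) (by norm_num), hN]
  rw [e, abs_of_pos (by norm_num : (0:ℝ) < 1 / 167)] at h
  obtain ⟨hl, hu⟩ := abs_le.1 h
  simp only [Finset.sum_range_succ, Finset.sum_range_zero] at hl hu
  norm_num at hl hu
  have hb2 := log_two_bounds
  have hb83 := log_eightythree_bounds
  constructor <;> linarith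

/-- `5.1532915944973 < log 173 < 5.1532915944985` (from `log(172 / 173)` by 6 terms of the logarithmic series; width 1.2e-12). [folklore] -/
theorem log_173_bounds : (5.1532915944973 : ℝ) < Real.log 173 ∧ Real.log 173 < 5.1532915944985 := by
  have hx : |(1 / 173 : ℝ)| < 1 := by rw [abs_of_pos (by norm_num)]; norm_num
  have h := Real.abs_log_sub_add_sum_range_le hx 6
  have hN : Real.log (172 : ℝ) = 2 * Real.log 2 + Real.log 43 := by
    rw [show (172 : ℝ) = 2 ^ 2 * 43 by norm_num]
    rw [Real.log_mul (by positivity) (by positivity)]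
    simp only [Real.log_pow]; push_cast; ring
  have e : Real.log (1 - 1 / 173 : ℝ) = (2 * Real.log 2 + Real.log 43) - Real.log 173 := by
    rw [show (1 - 1 / 173 : ℝ) = (172 : ℝ) / 173 by norm_num, Real.log_div (by norm_num) (by norm_num), hN]
  rw [e, abs_of_pos (by norm_num : (0:ℝ) < 1 / 173)] at h
  obtain ⟨hl, hu⟩ := abs_le.1 h
  simp only [Finset.sum_range_succ, Finset.sum_range_zero] at hl hu
  norm_num at hl hu
  have hb2 := log_two_bounds
  have hb43 := log_fortythree_bounds
  constructor <;> linarith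

/-- `5.1873858058403 < log 179 < 5.1873858058414` (from `log(178 / 179)` by 6 terms of the logarithmic series; width 1.1e-12). [folklore] -/
theorem log_179_bounds : (5.1873858058403 : ℝ) < Real.log 179 ∧ Real.log 179 < 5.1873858058414 := by
  have hx : |(1 / 179 : ℝ)| < 1 := by rw [abs_of_pos (by norm_num)]; norm_num
  have h := Real.abs_log_sub_add_sum_range_le hx 6
  have hN : Real.log (178 : ℝ) = Real.log 2 + Real.log 89 := by
    rw [show (178 : ℝ) = 2 * 89 by norm_num]
    rw [Real.log_mul (by positivity) (by positivity)]
  have e : Real.log (1 - 1 / 179 : ℝ) = (Real.log 2 + Real.log 89) - Real.log 179 := by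
    rw [show (1 - 1 / 179 : ℝ) = (178 : ℝ) / 179 by norm_num, Real.log_div (by norm_num) (by norm_num), hN]
  rw [e, abs_of_pos (by norm_num : (0:ℝ) < 1 / 179)] at h
  obtain ⟨hl, hu⟩ := abs_le.1 h
  simp only [Finset.sum_range_succ, Finset.sum_range_zero] at hl hu
  norm_num at hl hu
  have hb2 := log_two_bounds
  have hb89 := log_eightynine_bounds
  constructor <;> linarith

/-- `5.1984970312653 < log 181 < 5.1984970312665` (from `log(179 / 181)` by 7 terms of the logarithmic series; width 1.2e-12). [folklore] -/
theorem log_181_bounds : (5.1984970312653 : ℝ) < Real.log 181 ∧ Real.log 181 < 5.1984970312665 := by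
  have hx : |(2 / 181 : ℝ)| < 1 := by rw [abs_of_pos (by norm_num)]; norm_num
  have h := Real.abs_log_sub_add_sum_range_le hx 7
  have e : Real.log (1 - 2 / 181 : ℝ) = (Real.log 179) - Real.log 181 := by
    rw [show (1 - 2 / 181 : ℝ) = (179 : ℝ) / 181 by norm_num, Real.log_div (by norm_num) (by norm_num)]
  rw [e, abs_of_pos (by norm_num : (0:ℝ) < 2 / 181)] at h
  obtain ⟨hl, hu⟩ := abs_le.1 h
  simp only [Finset.sum_range_succ, Finset.sum_range_zero] at hl hu
  norm_num at hl hu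
  have hb179 := log_179_bounds
  constructor <;> linarith

/-- `5.2522734280462 < log 191 < 5.2522734280472` (from `log(191 / 192)` by 6 terms of the logarithmic series; width 1.0e-12). [folklore] -/
theorem log_191_bounds : (5.2522734280462 : ℝ) < Real.log 191 ∧ Real.log 191 < 5.2522734280472 := by
  have hx : |(1 / 192 : ℝ)| < 1 := by rw [abs_of_pos (by norm_num)]; norm_num
  have h := Real.abs_log_sub_add_sum_range_le hx 6
  have hN : Real.log (192 : ℝ) = 6 * Real.log 2 + Real.log 3 := by
    rw [show (192 : ℝ) = 2 ^ 6 * 3 by norm_num]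
    rw [Real.log_mul (by positivity) (by positivity)]
    simp only [Real.log_pow]; push_cast; ring
  have e : Real.log (1 - 1 / 192 : ℝ) = Real.log 191 - (6 * Real.log 2 + Real.log 3) := by
    rw [show (1 - 1 / 192 : ℝ) = (191 : ℝ) / 192 by norm_num, Real.log_div (by norm_num) (by norm_num), hN]
  rw [e, abs_of_pos (by norm_num : (0:ℝ) < 1 / 192)] at h
  obtain ⟨hl, hu⟩ := abs_le.1 h
  simp only [Finset.sum_range_succ, Finset.sum_range_zero] at hl hu
  norm_num at hl hu
  have hb2 := log_two_bounds
  have hb3 := log_three_bounds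
  constructor <;> linarith

/-- `5.2626901889045 < log 193 < 5.2626901889055` (from `log(192 / 193)` by 6 terms of the logarithmic series; width 1.0e-12). [folklore] -/
theorem log_193_bounds : (5.2626901889045 : ℝ) < Real.log 193 ∧ Real.log 193 < 5.2626901889055 := by
  have hx : |(1 / 193 : ℝ)| < 1 := by rw [abs_of_pos (by norm_num)]; norm_num
  have h := Real.abs_log_sub_add_sum_range_le hx 6
  have hN : Real.log (192 : ℝ) = 6 * Real.log 2 + Real.log 3 := by
    rw [show (192 : ℝ) = 2 ^ 6 * 3 by norm_num]
    rw [Real.log_mul (by positivity) (by positivity)]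
    simp only [Real.log_pow]; push_cast; ring
  have e : Real.log (1 - 1 / 193 : ℝ) = (6 * Real.log 2 + Real.log 3) - Real.log 193 := by
    rw [show (1 - 1 / 193 : ℝ) = (192 : ℝ) / 193 by norm_num, Real.log_div (by norm_num) (by norm_num), hN]
  rw [e, abs_of_pos (by norm_num : (0:ℝ) < 1 / 193)] at h
  obtain ⟨hl, hu⟩ := abs_le.1 h
  simp only [Finset.sum_range_succ, Finset.sum_range_zero] at hl hu
  norm_num at hl hu
  have hb2 := log_two_bounds
  have hb3 := log_three_bounds
  constructor <;> linarith

/-- `5.2832037287374 < log 197 < 5.2832037287385` (from `log(196 / 197)` by 6 terms of the logarithmic series; width 1.1e-12). [folklore] -/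
theorem log_197_bounds : (5.2832037287374 : ℝ) < Real.log 197 ∧ Real.log 197 < 5.2832037287385 := by
  have hx : |(1 / 197 : ℝ)| < 1 := by rw [abs_of_pos (by norm_num)]; norm_num
  have h := Real.abs_log_sub_add_sum_range_le hx 6
  have hN : Real.log (196 : ℝ) = 2 * Real.log 2 + 2 * Real.log 7 := by
    rw [show (196 : ℝ) = 2 ^ 2 * 7 ^ 2 by norm_num]
    rw [Real.log_mul (by positivity) (by positivity)]
    simp only [Real.log_pow]; push_cast; ring
  have e : Real.log (1 - 1 / 197 : ℝ) = (2 * Real.log 2 + 2 * Real.log 7) - Real.log 197 := by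
    rw [show (1 - 1 / 197 : ℝ) = (196 : ℝ) / 197 by norm_num, Real.log_div (by norm_num) (by norm_num), hN]
  rw [e, abs_of_pos (by norm_num : (0:ℝ) < 1 / 197)] at h
  obtain ⟨hl, hu⟩ := abs_le.1 h
  simp only [Finset.sum_range_succ, Finset.sum_range_zero] at hl hu
  norm_num at hl hu
  have hb2 := log_two_bounds
  have hb7 := log_seven_bounds
  constructor <;> linarith

/-- `5.2933048247241 < log 199 < 5.2933048247251` (from `log(199 / 200)` by 6 terms of the logarithmic series; width 1.0e-12). [folklore] -/
theorem log_199_bounds : (5.2933048247241 : ℝ) < Real.log 199 ∧ Real.log 199 < 5.2933048247251 := by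
  have hx : |(1 / 200 : ℝ)| < 1 := by rw [abs_of_pos (by norm_num)]; norm_num
  have h := Real.abs_log_sub_add_sum_range_le hx 6
  have hN : Real.log (200 : ℝ) = 3 * Real.log 2 + 2 * Real.log 5 := by
    rw [show (200 : ℝ) = 2 ^ 3 * 5 ^ 2 by norm_num]
    rw [Real.log_mul (by positivity) (by positivity)]
    simp only [Real.log_pow]; push_cast; ring
  have e : Real.log (1 - 1 / 200 : ℝ) = Real.log 199 - (3 * Real.log 2 + 2 * Real.log 5) := by
    rw [show (1 - 1 / 200 : ℝ) = (199 : ℝ) / 200 by norm_num, Real.log_div (by norm_num) (by norm_num), hN]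
  rw [e, abs_of_pos (by norm_num : (0:ℝ) < 1 / 200)] at h
  obtain ⟨hl, hu⟩ := abs_le.1 h
  simp only [Finset.sum_range_succ, Finset.sum_range_zero] at hl hu
  norm_num at hl hu
  have hb2 := log_two_bounds
  have hb5 := log_five_bounds
  constructor <;> linarith

/-- `5.3518581334755 < log 211 < 5.3518581334769` (from `log(209 / 211)` by 6 terms of the logarithmic series; width 1.4e-12). [folklore] -/
theorem log_211_bounds : (5.3518581334755 : ℝ) < Real.log 211 ∧ Real.log 211 < 5.3518581334769 := by
  have hx : |(2 / 211 : ℝ)| < 1 := by rw [abs_of_pos (by norm_num)]; norm_num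
  have h := Real.abs_log_sub_add_sum_range_le hx 6
  have hN : Real.log (209 : ℝ) = Real.log 11 + Real.log 19 := by
    rw [show (209 : ℝ) = 11 * 19 by norm_num]
    rw [Real.log_mul (by positivity) (by positivity)]
  have e : Real.log (1 - 2 / 211 : ℝ) = (Real.log 11 + Real.log 19) - Real.log 211 := by
    rw [show (1 - 2 / 211 : ℝ) = (209 : ℝ) / 211 by norm_num, Real.log_div (by norm_num) (by norm_num), hN]
  rw [e, abs_of_pos (by norm_num : (0:ℝ) < 2 / 211)] at h
  obtain ⟨hl, hu⟩ := abs_le.1 h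
  simp only [Finset.sum_range_succ, Finset.sum_range_zero] at hl hu
  norm_num at hl hu
  have hb11 := log_eleven_bounds
  have hb19 := log_nineteen_bounds
  constructor <;> linarith

/-- `5.4071717714596 < log 223 < 5.4071717714606` (from `log(223 / 224)` by 5 terms of the logarithmic series; width 1.0e-12). [folklore] -/
theorem log_223_bounds : (5.4071717714596 : ℝ) < Real.log 223 ∧ Real.log 223 < 5.4071717714606 := by
  have hx : |(1 / 224 : ℝ)| < 1 := by rw [abs_of_pos (by norm_num)]; norm_num
  have h := Real.abs_log_sub_add_sum_range_le hx 5
  have hN : Real.log (224 : ℝ) = 5 * Real.log 2 + Real.log 7 := by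
    rw [show (224 : ℝ) = 2 ^ 5 * 7 by norm_num]
    rw [Real.log_mul (by positivity) (by positivity)]
    simp only [Real.log_pow]; push_cast; ring
  have e : Real.log (1 - 1 / 224 : ℝ) = Real.log 223 - (5 * Real.log 2 + Real.log 7) := by
    rw [show (1 - 1 / 224 : ℝ) = (223 : ℝ) / 224 by norm_num, Real.log_div (by norm_num) (by norm_num), hN]
  rw [e, abs_of_pos (by norm_num : (0:ℝ) < 1 / 224)] at h
  obtain ⟨hl, hu⟩ := abs_le.1 h
  simp only [Finset.sum_range_succ, Finset.sum_range_zero] at hl hu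
  norm_num at hl hu
  have hb2 := log_two_bounds
  have hb7 := log_seven_bounds
  constructor <;> linarith

/-- `5.4249500174809 < log 227 < 5.4249500174820` (from `log(226 / 227)` by 5 terms of the logarithmic series; width 1.1e-12). [folklore] -/
theorem log_227_bounds : (5.4249500174809 : ℝ) < Real.log 227 ∧ Real.log 227 < 5.4249500174820 := by
  have hx : |(1 / 227 : ℝ)| < 1 := by rw [abs_of_pos (by norm_num)]; norm_num
  have h := Real.abs_log_sub_add_sum_range_le hx 5
  have hN : Real.log (226 : ℝ) = Real.log 2 + Real.log 113 := by
    rw [show (226 : ℝ) = 2 * 113 by norm_num]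
    rw [Real.log_mul (by positivity) (by positivity)]
  have e : Real.log (1 - 1 / 227 : ℝ) = (Real.log 2 + Real.log 113) - Real.log 227 := by
    rw [show (1 - 1 / 227 : ℝ) = (226 : ℝ) / 227 by norm_num, Real.log_div (by norm_num) (by norm_num), hN]
  rw [e, abs_of_pos (by norm_num : (0:ℝ) < 1 / 227)] at h
  obtain ⟨hl, hu⟩ := abs_le.1 h
  simp only [Finset.sum_range_succ, Finset.sum_range_zero] at hl hu
  norm_num at hl hu
  have hb2 := log_two_bounds
  have hb113 := log_hundredthirteen_bounds
  constructor <;> linarith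

/-- `5.4337220035537 < log 229 < 5.4337220035549` (from `log(227 / 229)` by 6 terms of the logarithmic series; width 1.2e-12). [folklore] -/
theorem log_229_bounds : (5.4337220035537 : ℝ) < Real.log 229 ∧ Real.log 229 < 5.4337220035549 := by
  have hx : |(2 / 229 : ℝ)| < 1 := by rw [abs_of_pos (by norm_num)]; norm_num
  have h := Real.abs_log_sub_add_sum_range_le hx 6
  have e : Real.log (1 - 2 / 229 : ℝ) = (Real.log 227) - Real.log 229 := by
    rw [show (1 - 2 / 229 : ℝ) = (227 : ℝ) / 229 by norm_num, Real.log_div (by norm_num) (by norm_num)]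
  rw [e, abs_of_pos (by norm_num : (0:ℝ) < 2 / 229)] at h
  obtain ⟨hl, hu⟩ := abs_le.1 h
  simp only [Finset.sum_range_succ, Finset.sum_range_zero] at hl hu
  norm_num at hl hu
  have hb227 := log_227_bounds
  constructor <;> linarith

/-- `5.4510384535651 < log 233 < 5.4510384535662` (from `log(232 / 233)` by 5 terms of the logarithmic series; width 1.1e-12). [folklore] -/
theorem log_233_bounds : (5.4510384535651 : ℝ) < Real.log 233 ∧ Real.log 233 < 5.4510384535662 := by
  have hx : |(1 / 233 : ℝ)| < 1 := by rw [abs_of_pos (by norm_num)]; norm_num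
  have h := Real.abs_log_sub_add_sum_range_le hx 5
  have hN : Real.log (232 : ℝ) = 3 * Real.log 2 + Real.log 29 := by
    rw [show (232 : ℝ) = 2 ^ 3 * 29 by norm_num]
    rw [Real.log_mul (by positivity) (by positivity)]
    simp only [Real.log_pow]; push_cast; ring
  have e : Real.log (1 - 1 / 233 : ℝ) = (3 * Real.log 2 + Real.log 29) - Real.log 233 := by
    rw [show (1 - 1 / 233 : ℝ) = (232 : ℝ) / 233 by norm_num, Real.log_div (by norm_num) (by norm_num), hN]
  rw [e, abs_of_pos (by norm_num : (0:ℝ) < 1 / 233)] at h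
  obtain ⟨hl, hu⟩ := abs_le.1 h
  simp only [Finset.sum_range_succ, Finset.sum_range_zero] at hl hu
  norm_num at hl hu
  have hb2 := log_two_bounds
  have hb29 := log_twentynine_bounds
  constructor <;> linarith

end Summit.RiemannHypothesis.RiemannHypothesis.Theorems.DbrWall.LogTable
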